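import Mathlib
import HarnessLib

/-!
# Route `UnitScaleTilt`, crux K1 child «MinimiserStabilityRegPr» (stmt-QuantumFields-19200), stub EX, route (α), node (AVG-SYM) — **THE TWISTED-RIGHT-INVERSE ALGEBRA (abstract
# socket for OWNER RULING g26-№1 (2)∕(3e))**: if `QSym ∘ H = id`, `QTw = QSym − Dc ∘ r`, `QTw ∘ Df = Dc ∘ Q′` (restricted covariance) and `Q′ ∘ ȟ = id`, then
# `H^{tw} := H + Df ∘ ȟ ∘ r ∘ H` is an EXACT right inverse of `QTw`, with the sup row `‖H^{tw}X‖ ≤ B_H(1 + c_D·c_ȟ·c_r)‖X‖`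

Cell `ym3-torus`, width seat `ym-ust-20520-w3` (gen 4).  Pure linear algebra ∕ normed-space bookkeeping (no lattice letters); the instantiation at the route's `QSym`, `QTw`,
`D_{U₀}`, `D_{Ū₀}`, `r`, `Q′`, `ȟ` is ★w5-20520 g3's (3e) `exists_rightInv_QTw_of_HSym`.  THEOREMS ONLY (0 `def`, 0 `sorry`).  YM₃ on T³ is a ladder rung (R3), not the Clay problem;
nothing here claims the stub, the crux, d = 4 or the mass gap.  `--supports stmt-QuantumFields-19200 --as helper`; count-neutral.

THE PRINT.  [Balaban1985BackgroundPropagators] p. 394 (3.22)–(3.25): correcting a right inverse of the averaging operator by a gauge term `D_{U}λ`; FINDING w5-3 §3(T)(ii) ∕ RULING g26-№1 (2):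
«`H^{tw} X := H^{sym} X + D_{U₀} ȟ(r(H^{sym} X))` ⇒ `QTw H^{tw} X = X − D r(H^{sym}X) + D Q′ȟ(r(H^{sym}X)) = X`».

References: T. Bałaban, CMP **99** (1985) 389–434 [Balaban1985BackgroundPropagators] ((3.18)–(3.25) pp.393–394); CMP **102** (1985) 277–309 [Balaban1985Variational] ((45)–(46) p.285).
-/

set_option autoImplicit false

namespace Summit.QuantumFields.YangMills.Theorems.Prop7TwistedRightInverse

section Algebra

variable {R : Type*} [CommRing R] {E G Λf Λc : Type*} [AddCommGroup E] [Module R E] [AddCommGroup G] [Module R G]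
  [AddCommGroup Λf] [Module R Λf] [AddCommGroup Λc] [Module R Λc]

/-- ★ **THE TWISTED RIGHT INVERSE, ALGEBRA.**  Fine one-forms `E`, coarse one-forms `G`, fine ∕ coarse gauge parameters `Λf` ∕ `Λc`; `QSym QTw : E → G` (the pinned and the
twisted linearised averages), `H : G → E` with `QSym (H X) = X`, gauge derivatives `Df : Λf → E`, `Dc : Λc → G`, the bridge `QTw Y = QSym Y − Dc (r Y)`, the restricted covariance
`QTw (Df λ) = Dc (Q′ λ)` and a right inverse `ȟ` of `Q′`.  Then `QTw (H X + Df (ȟ (r (H X)))) = X`. [cite: Balaban1985BackgroundPropagators, (3.22)-(3.25) p.394] -/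
theorem QTw_twistedRightInv_apply (QSym QTw : E →ₗ[R] G) (H : G →ₗ[R] E) (Df : Λf →ₗ[R] E) (Dc : Λc →ₗ[R] G) (r : E →ₗ[R] Λc)
    (Q' : Λf →ₗ[R] Λc) (hh : Λc →ₗ[R] Λf)
    (hQH : ∀ X, QSym (H X) = X) (hTw : ∀ Y, QTw Y = QSym Y - Dc (r Y)) (hcov : ∀ lam, QTw (Df lam) = Dc (Q' lam)) (hQ'h : ∀ η, Q' (hh η) = η)
    (X : G) : QTw (H X + Df (hh (r (H X)))) = X := by
  rw [map_add, hcov, hQ'h, hTw, hQH, sub_add_cancel]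

/-- The same for the bundled map `H^{tw} := H + Df ∘ ȟ ∘ r ∘ H`. [cite: Balaban1985BackgroundPropagators, (3.22)-(3.25) p.394] -/
theorem QTw_comp_twistedRightInv (QSym QTw : E →ₗ[R] G) (H : G →ₗ[R] E) (Df : Λf →ₗ[R] E) (Dc : Λc →ₗ[R] G) (r : E →ₗ[R] Λc)
    (Q' : Λf →ₗ[R] Λc) (hh : Λc →ₗ[R] Λf)
    (hQH : ∀ X, QSym (H X) = X) (hTw : ∀ Y, QTw Y = QSym Y - Dc (r Y)) (hcov : ∀ lam, QTw (Df lam) = Dc (Q' lam)) (hQ'h : ∀ η, Q' (hh η) = η)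
    (X : G) : QTw ((H + Df ∘ₗ hh ∘ₗ r ∘ₗ H) X) = X := by
  rw [LinearMap.add_apply, LinearMap.comp_apply, LinearMap.comp_apply, LinearMap.comp_apply]
  exact QTw_twistedRightInv_apply QSym QTw H Df Dc r Q' hh hQH hTw hcov hQ'h X

end Algebra

section Normed

variable {E G Λf Λc : Type*} [NormedAddCommGroup E] [NormedSpace ℂ E] [NormedAddCommGroup G] [NormedSpace ℂ G]
  [NormedAddCommGroup Λf] [NormedSpace ℂ Λf] [NormedAddCommGroup Λc] [NormedSpace ℂ Λc]

/-- ★★ **THE TWISTED RIGHT INVERSE WITH ITS SUP ROW.**  Under the algebra of `QTw_twistedRightInv_apply` and the pointwise bounds `‖H X‖ ≤ B_H‖X‖`, `‖Df λ‖ ≤ c_D‖λ‖`,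
`‖ȟ η‖ ≤ c_h‖η‖`, `‖r Y‖ ≤ c_r‖Y‖` (`c_D, c_h, c_r ≥ 0`): there is a `ℂ`-linear `Htw` with `QTw (Htw X) = X` and `‖Htw X‖ ≤ B_H·(1 + c_D·c_h·c_r)·‖X‖` — the shape of the
knit's `h46tw` ∃-row. [cite: Balaban1985BackgroundPropagators, (3.22)-(3.25) p.394; Balaban1985Variational, (45)-(46) p.285] -/
theorem exists_rightInv_of_twist (QSym QTw : E →ₗ[ℂ] G) (H : G →ₗ[ℂ] E) (Df : Λf →ₗ[ℂ] E) (Dc : Λc →ₗ[ℂ] G) (r : E →ₗ[ℂ] Λc)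
    (Q' : Λf →ₗ[ℂ] Λc) (hh : Λc →ₗ[ℂ] Λf)
    (hQH : ∀ X, QSym (H X) = X) (hTw : ∀ Y, QTw Y = QSym Y - Dc (r Y)) (hcov : ∀ lam, QTw (Df lam) = Dc (Q' lam)) (hQ'h : ∀ η, Q' (hh η) = η)
    {B_H c_D c_h c_r : ℝ} (hcD : 0 ≤ c_D) (hch : 0 ≤ c_h) (hcr : 0 ≤ c_r)
    (hHn : ∀ X, ‖H X‖ ≤ B_H * ‖X‖) (hDn : ∀ lam, ‖Df lam‖ ≤ c_D * ‖lam‖) (hhn : ∀ η, ‖hh η‖ ≤ c_h * ‖η‖) (hrn : ∀ Y, ‖r Y‖ ≤ c_r * ‖Y‖) :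
    ∃ Htw : G →ₗ[ℂ] E, (∀ X, QTw (Htw X) = X) ∧ ∀ X, ‖Htw X‖ ≤ B_H * (1 + c_D * c_h * c_r) * ‖X‖ := by
  refine ⟨H + Df ∘ₗ hh ∘ₗ r ∘ₗ H, QTw_comp_twistedRightInv QSym QTw H Df Dc r Q' hh hQH hTw hcov hQ'h, fun X => ?_⟩
  rw [LinearMap.add_apply, LinearMap.comp_apply, LinearMap.comp_apply, LinearMap.comp_apply]
  have h1 := hHn X
  have h2 : ‖Df (hh (r (H X)))‖ ≤ c_D * (c_h * (c_r * (B_H * ‖X‖))) :=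
    (hDn _).trans (mul_le_mul_of_nonneg_left ((hhn _).trans (mul_le_mul_of_nonneg_left ((hrn _).trans (mul_le_mul_of_nonneg_left h1 hcr)) hch)) hcD)
  calc ‖H X + Df (hh (r (H X)))‖ ≤ ‖H X‖ + ‖Df (hh (r (H X)))‖ := norm_add_le _ _
    _ ≤ B_H * ‖X‖ + c_D * (c_h * (c_r * (B_H * ‖X‖))) := add_le_add h1 h2
    _ = B_H * (1 + c_D * c_h * c_r) * ‖X‖ := by ring

end Normed

end Summit.QuantumFields.YangMills.Theorems.Prop7TwistedRightInverse
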